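import Summits.RiemannHypothesis.RiemannHypothesis.Theorems.SpectralTraceWindowTraceArchStubBandlimitedTestAux
import Literature.Analysis.Fourier.SelbergMajorantsFourier
import Literature.NumberTheory.LFunctions.RiemannSiegel
import Literature.NumberTheory.LFunctions.WeilArchimedeanPositivityProofs
import Literature.NumberTheory.LFunctions.ExplicitFormulaPsiOne
import Literature.Analysis.SpecialFunctions.DigammaVerticalSeries
import Mathlib.Analysis.SpecialFunctions.ImproperIntegrals
import Mathlib.MeasureTheory.Group.Integral
import HarnessLib

/-!
# The two-sided counting law of a witness — the Weil side (`stub_countingLaw`, Aux)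

Auxiliary lemmas for the stub `stub_countingLaw` of the line `defect-compactness-design`
(wave 2, structure of witnesses) for the crux `WindowTraceArch` (stmt-RiemannHypothesis-11195;
skeleton `Summit.RiemannHypothesis.RiemannHypothesis.Cruxes.WindowTraceArch.DefectCompactnessDesign`).

**Statement (landing anchor `stub_countingLaw_archSide`).** There are `A, B` such that for every
`T ≥ 0` and every continuous `g` supported in `[-log 2, log 2]` whose transform on `s = 1/2 + zi`
is Selberg's majorant `F₊` (resp. minorant `F₋`) of `𝟙_{[0,T]}` with bandwidth `Δ = (log 2)/2π`,
and with `g(0) = (T ± 2π/log 2)/(2π)`: `|Re W(g) − θ(T)/π| ≤ A + B log(1 + T)`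
(`θ = riemannSiegelTheta`, `W = weilFunctional`).

**Proof.** On the window the prime term vanishes (`weilPrimeTerm_eq_zero_of_tsupport_subset`), so
`W(g) = ĝ(0) + ĝ(1) + (1/2π) ∫ F±(u) Re ψ(1/4 + iu/2) du − g(0) log π` with `ĝ(0) = F±(i/2)`,
`ĝ(1) = F±(−i/2)` (both `O(1)`: `norm_selbergMajorant_le`), while BY DEFINITION
`θ(T)/π = (1/2π) ∫ 𝟙_{[0,T]}(u) Re ψ(1/4 + iu/2) du − T (log π)/(2π)`. Hence
`Re W(g) − θ(T)/π = Re(F±(i/2) + F±(−i/2)) + (1/2π) ∫ (F± − 𝟙_{[0,T]}) Re ψ ∓ (log π)/(log 2)`; the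
integral is `O(1 + log(1+T))` uniformly in `T`: `|F± − 𝟙_{[0,T]}|(u) ≤ 2w(u) + 2w(u − T)` with
`w(v) = (1 + Δ²v²)⁻¹` (`selbergMajorantReal_sub_indicator_eq`, `abs_beurlingReal_sub_sign_le`),
`|Re ψ(1/4 + iu/2)| ≤ L(u) = 5 + log(1 + |u|)` (`reDigammaQuarter_le_log`,
`re_digamma_one_quarter_ge`), `L(u) ≤ L(u − T) + log(1 + T)`, and translation invariance give the
bound `4 ∫ w L + 2 (∫ w) log(1+T)`.

**Sources.** J. D. Vaaler, *Some extremal functions in Fourier analysis*, Bull. AMS 12 (1985),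
Thm. 8 (Selberg's functions; tree `SelbergMajorants.lean`); E. C. Titchmarsh, *The Theory of the
Riemann Zeta-Function* (1986), §4.17 (`θ`). All ingredients are proved tree / Mathlib facts. [folklore]
-/

set_option linter.dupNamespace false

noncomputable section

open Complex Filter Set MeasureTheory
open scoped Real Topology BigOperators

namespace Summit.RiemannHypothesis.RiemannHypothesis.Theorems.SpectralTraceWindowTraceArch

open Literature.NumberTheory.LFunctions Literature.Analysis.Fourier Literature.Analysis.SpecialFunctions

/-! ## The archimedean weight and the two integrable weights -/

/-- `|Re ψ(1/4 + iu/2)| ≤ 5 + log(1 + |u|)` for all real `u` (upper bound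
`reDigammaQuarter_le_log`; lower bound `Re ψ(1/4 + iu/2) ≥ Re ψ(1/4) ≥ −4.23`). [folklore] -/
theorem stub_countingLaw_abs_reDigammaQuarter_le (u : ℝ) :
    |reDigammaQuarter u| ≤ 5 + Real.log (1 + |u|) := by
  have h1 := WindowTraceArch.Negative.reDigammaQuarter_le_log u
  have h2 := reDigammaQuarter_zero_le u
  have h3 := re_digamma_one_quarter_ge
  have h4 : reDigammaQuarter 0 = (Complex.digamma (1 / 4)).re := reDigammaQuarter_zero
  have hlog : 0 ≤ Real.log (1 + |u|) := Real.log_nonneg (by linarith [abs_nonneg u])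
  rw [abs_le]; constructor <;> linarith

/-- The weight `w(v) L(v) = (1 + (Δv)²)⁻¹ (5 + log(1 + |v|))` is integrable (`0 < Δ ≤ 1`;
comparison with `Δ⁻² (5 + 2 log(1+|v|))/(1/4 + v²)`). [folklore] -/
theorem stub_countingLaw_integrable_weight {Δ : ℝ} (hΔ0 : 0 < Δ) (hΔ1 : Δ ≤ 1) :
    Integrable fun v : ℝ => (1 + (Δ * v) ^ 2)⁻¹ * (5 + Real.log (1 + |v|)) := by
  have hint := (PsiOneExplicit.integrable_left_majorant (A := 5) (by norm_num)).const_mul (Δ ^ 2)⁻¹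
  refine hint.mono' ?_ (ae_of_all _ fun v => ?_)
  · refine Continuous.aestronglyMeasurable (Continuous.mul ?_ ?_)
    · exact Continuous.inv₀ (by fun_prop) fun v => (by positivity : (0 : ℝ) < 1 + (Δ * v) ^ 2).ne'
    · exact continuous_const.add ((continuous_const.add continuous_abs).log fun v =>
        (by positivity : (0 : ℝ) < 1 + |v|).ne')
  · have hlog : 0 ≤ Real.log (1 + |v|) := Real.log_nonneg (by linarith [abs_nonneg v])
    rw [Real.norm_of_nonneg (by positivity)]
    have hΔ2 : Δ ^ 2 ≤ 1 := by nlinarith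
    have hw : (1 + (Δ * v) ^ 2)⁻¹ ≤ (Δ ^ 2)⁻¹ * (1 / 4 + v ^ 2)⁻¹ := by
      calc (1 + (Δ * v) ^ 2)⁻¹ ≤ (Δ ^ 2 * (1 / 4 + v ^ 2))⁻¹ :=
            inv_anti₀ (by positivity) (by nlinarith [sq_nonneg v])
        _ = (Δ ^ 2)⁻¹ * (1 / 4 + v ^ 2)⁻¹ := mul_inv _ _
    calc (1 + (Δ * v) ^ 2)⁻¹ * (5 + Real.log (1 + |v|))
        ≤ ((Δ ^ 2)⁻¹ * (1 / 4 + v ^ 2)⁻¹) * (5 + 2 * Real.log (1 + |v|)) :=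
          mul_le_mul hw (by linarith) (by positivity) (by positivity)
      _ = (Δ ^ 2)⁻¹ * ((5 + 2 * Real.log (1 + |v|)) / (1 / 4 + v ^ 2)) := by ring

/-- `log(1 + |u|) ≤ log(1 + |u − T|) + log(1 + T)` for `T ≥ 0`. [folklore] -/
theorem stub_countingLaw_log_shift {T : ℝ} (hT : 0 ≤ T) (u : ℝ) :
    Real.log (1 + |u|) ≤ Real.log (1 + |u - T|) + Real.log (1 + T) := by
  have h1 : 1 + |u| ≤ (1 + |u - T|) * (1 + T) := by
    have : |u| ≤ |u - T| + T := by
      calc |u| = |(u - T) + T| := by ring_nf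
        _ ≤ |u - T| + |T| := abs_add_le _ _
        _ = |u - T| + T := by rw [abs_of_nonneg hT]
    nlinarith [abs_nonneg (u - T)]
  have h2 : Real.log (1 + |u|) ≤ Real.log ((1 + |u - T|) * (1 + T)) :=
    Real.log_le_log (by positivity) h1
  rwa [Real.log_mul (by positivity : (0 : ℝ) < 1 + |u - T|).ne'
    (by positivity : (0 : ℝ) < 1 + T).ne'] at h2

/-- **The weighted archimedean integral is `O(1 + log(1+T))` uniformly in `T`.** With
`w(v) = (1 + (Δv)²)⁻¹`, `L(v) = 5 + log(1+|v|)`: the function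
`u ↦ (2w(u) + 2w(u−T)) |Re ψ(1/4 + iu/2)|` is integrable with integral
`≤ 4 ∫ w L + 2 (∫ w) log(1 + T)` (translation invariance). [folklore] -/
theorem stub_countingLaw_weight_integral_le {Δ : ℝ} (hΔ0 : 0 < Δ) (hΔ1 : Δ ≤ 1) {T : ℝ} (hT : 0 ≤ T)
    (w L : ℝ → ℝ) (hw : ∀ v, w v = (1 + (Δ * v) ^ 2)⁻¹) (hL : ∀ v, L v = 5 + Real.log (1 + |v|)) :
    Integrable (fun u => (2 * w u + 2 * w (u - T)) * |reDigammaQuarter u|) ∧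
    ∫ u, (2 * w u + 2 * w (u - T)) * |reDigammaQuarter u| ≤
      4 * (∫ v, w v * L v) + 2 * (∫ v, w v) * Real.log (1 + T) := by
  have hw' : w = fun v => (1 + (Δ * v) ^ 2)⁻¹ := funext hw
  have hL' : L = fun v => 5 + Real.log (1 + |v|) := funext hL
  have hwL : Integrable (fun v => w v * L v) := by
    rw [hw', hL']; exact stub_countingLaw_integrable_weight hΔ0 hΔ1
  have hwi : Integrable w := by rw [hw']; exact integrable_inv_one_add_sq.comp_mul_left' hΔ0.ne'
  have hwc : Continuous w := by
    rw [hw']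
    exact Continuous.inv₀ (by fun_prop) fun v => (by positivity : (0 : ℝ) < 1 + (Δ * v) ^ 2).ne'
  have hlogT : 0 ≤ Real.log (1 + T) := Real.log_nonneg (by linarith)
  have hw0 : ∀ v, 0 ≤ w v := fun v => by rw [hw]; positivity
  -- the three-term majorant
  have h2a : Integrable (fun u => 2 * (w u * L u)) := hwL.const_mul 2
  have h2b : Integrable (fun u => 2 * (w (u - T) * L (u - T))) := (hwL.comp_sub_right T).const_mul 2
  have h2c : Integrable (fun u => 2 * Real.log (1 + T) * w (u - T)) :=
    (hwi.comp_sub_right T).const_mul _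
  have hab : Integrable (fun u => 2 * (w u * L u) + 2 * (w (u - T) * L (u - T))) := h2a.add h2b
  have hGi : Integrable (fun u => 2 * (w u * L u) + 2 * (w (u - T) * L (u - T)) +
      2 * Real.log (1 + T) * w (u - T)) := hab.add h2c
  have hFG : ∀ u, (2 * w u + 2 * w (u - T)) * |reDigammaQuarter u| ≤
      2 * (w u * L u) + 2 * (w (u - T) * L (u - T)) + 2 * Real.log (1 + T) * w (u - T) := by
    intro u
    have hψ : |reDigammaQuarter u| ≤ L u := by
      rw [hL]; exact stub_countingLaw_abs_reDigammaQuarter_le u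
    have hLu : L u ≤ L (u - T) + Real.log (1 + T) := by
      rw [hL, hL]; linarith [stub_countingLaw_log_shift hT u]
    nlinarith [mul_le_mul_of_nonneg_left hψ (hw0 u),
      mul_le_mul_of_nonneg_left (hψ.trans hLu) (hw0 (u - T))]
  have hF0 : ∀ u, 0 ≤ (2 * w u + 2 * w (u - T)) * |reDigammaQuarter u| := fun u => by
    have := hw0 u; have := hw0 (u - T); positivity
  have hFm : AEStronglyMeasurable (fun u => (2 * w u + 2 * w (u - T)) * |reDigammaQuarter u|) := by
    refine Continuous.aestronglyMeasurable ?_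
    have h1 : Continuous fun u => w (u - T) := hwc.comp (continuous_id.sub continuous_const)
    exact ((hwc.const_mul _).add (h1.const_mul _)).mul
      (continuous_abs.comp continuous_reDigammaQuarter)
  have hFi : Integrable (fun u => (2 * w u + 2 * w (u - T)) * |reDigammaQuarter u|) :=
    hGi.mono' hFm (ae_of_all _ fun u => by rw [Real.norm_of_nonneg (hF0 u)]; exact hFG u)
  refine ⟨hFi, ?_⟩
  have ht1 : ∫ u, w (u - T) * L (u - T) = ∫ v, w v * L v :=
    integral_sub_right_eq_self (μ := volume) (fun v => w v * L v) T
  have ht2 : ∫ u, w (u - T) = ∫ v, w v := integral_sub_right_eq_self (μ := volume) w T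
  calc ∫ u, (2 * w u + 2 * w (u - T)) * |reDigammaQuarter u|
      ≤ ∫ u, (2 * (w u * L u) + 2 * (w (u - T) * L (u - T)) + 2 * Real.log (1 + T) * w (u - T)) :=
        integral_mono hFi hGi hFG
    _ = 2 * (∫ v, w v * L v) + 2 * (∫ v, w v * L v) + 2 * Real.log (1 + T) * ∫ v, w v := by
        rw [integral_add hab h2c, integral_add h2a h2b, integral_const_mul, integral_const_mul,
          integral_const_mul, ht1, ht2]
    _ = 4 * (∫ v, w v * L v) + 2 * (∫ v, w v) * Real.log (1 + T) := by ring

/-! ## The deviations `F± − 𝟙_{[0,T]}` and their weighted integrals -/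

/-- `|F₊(u) − 𝟙_{[0,T]}(u)| ≤ 2w(u) + 2w(u − T)` off the endpoints. [folklore] -/
theorem stub_countingLaw_majorant_dev {Δ : ℝ} (hΔ : 0 < Δ) {T : ℝ} (hT : 0 ≤ T) {u : ℝ}
    (hu0 : u ≠ 0) (huT : u ≠ T) :
    |selbergMajorantReal Δ 0 T u - (Icc 0 T).indicator (fun _ => (1 : ℝ)) u| ≤
      2 * (1 + (Δ * u) ^ 2)⁻¹ + 2 * (1 + (Δ * (u - T)) ^ 2)⁻¹ := by
  rw [selbergMajorantReal_sub_indicator_eq hΔ hT hu0 huT, sub_zero]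
  have h1 := abs_beurlingReal_sub_sign_le (Δ * u)
  have h2 := abs_beurlingReal_sub_sign_le (Δ * (T - u))
  rw [show (Δ * (T - u)) ^ 2 = (Δ * (u - T)) ^ 2 by ring] at h2
  have h3 := abs_add_le (beurlingReal (Δ * u) - Real.sign (Δ * u))
    (beurlingReal (Δ * (T - u)) - Real.sign (Δ * (T - u)))
  rw [abs_div, abs_two]; linarith

/-- `|F₋(u) − 𝟙_{[0,T]}(u)| ≤ 2w(u) + 2w(u − T)` off the endpoints. [folklore] -/
theorem stub_countingLaw_minorant_dev {Δ : ℝ} (hΔ : 0 < Δ) {T : ℝ} (hT : 0 ≤ T) {u : ℝ}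
    (hu0 : u ≠ 0) (huT : u ≠ T) :
    |selbergMinorantReal Δ 0 T u - (Icc 0 T).indicator (fun _ => (1 : ℝ)) u| ≤
      2 * (1 + (Δ * u) ^ 2)⁻¹ + 2 * (1 + (Δ * (u - T)) ^ 2)⁻¹ := by
  rw [abs_sub_comm, indicator_sub_selbergMinorantReal_eq hΔ hT hu0 huT, zero_sub]
  have h1 := abs_beurlingReal_sub_sign_le (Δ * -u)
  have h2 := abs_beurlingReal_sub_sign_le (Δ * (u - T))
  rw [show (Δ * -u) ^ 2 = (Δ * u) ^ 2 by ring] at h1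
  have h3 := abs_add_le (beurlingReal (Δ * -u) - Real.sign (Δ * -u))
    (beurlingReal (Δ * (u - T)) - Real.sign (Δ * (u - T)))
  rw [abs_div, abs_two]; linarith

/-- **The weighted deviation integral.** If `|D(u)| ≤ 2w(u) + 2w(u−T)` off `{0, T}` (`D`
measurable), then `D · Re ψ(1/4 + i·/2)` is integrable and
`|∫ D(u) Re ψ(1/4 + iu/2) du| ≤ 4 ∫ w L + 2 (∫ w) log(1+T)`. [folklore] -/
theorem stub_countingLaw_dev_integral {Δ : ℝ} (hΔ0 : 0 < Δ) (hΔ1 : Δ ≤ 1) {T : ℝ} (hT : 0 ≤ T)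
    (w L : ℝ → ℝ) (hw : ∀ v, w v = (1 + (Δ * v) ^ 2)⁻¹) (hL : ∀ v, L v = 5 + Real.log (1 + |v|))
    {D : ℝ → ℝ} (hDm : AEStronglyMeasurable D)
    (hdev : ∀ u : ℝ, u ≠ 0 → u ≠ T → |D u| ≤ 2 * w u + 2 * w (u - T)) :
    Integrable (fun u => D u * reDigammaQuarter u) ∧
    |∫ u, D u * reDigammaQuarter u| ≤ 4 * (∫ v, w v * L v) + 2 * (∫ v, w v) * Real.log (1 + T) := by
  obtain ⟨hBi, hBle⟩ := stub_countingLaw_weight_integral_le hΔ0 hΔ1 hT w L hw hL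
  have hae : ∀ᵐ u, ‖D u * reDigammaQuarter u‖ ≤ (2 * w u + 2 * w (u - T)) * |reDigammaQuarter u| := by
    filter_upwards [ae_ne_endpoints 0 T] with u hu
    rw [norm_mul, Real.norm_eq_abs, Real.norm_eq_abs]
    exact mul_le_mul_of_nonneg_right (hdev u hu.1 hu.2) (abs_nonneg _)
  have hInt : Integrable (fun u => D u * reDigammaQuarter u) :=
    hBi.mono' (hDm.mul continuous_reDigammaQuarter.aestronglyMeasurable) hae
  refine ⟨hInt, ?_⟩
  calc |∫ u, D u * reDigammaQuarter u| = ‖∫ u, D u * reDigammaQuarter u‖ := (Real.norm_eq_abs _).symm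
    _ ≤ ∫ u, (2 * w u + 2 * w (u - T)) * |reDigammaQuarter u| := norm_integral_le_of_norm_le hBi hae
    _ ≤ _ := hBle

/-! ## The two sides: `θ(T)/π` and `Re W(g)` as archimedean integrals -/

/-- `θ(T)/π = (1/2π) ∫ 𝟙_{[0,T]}(u) Re ψ(1/4 + iu/2) du − T (log π)/(2π)` for `T ≥ 0`
(the DEFINITION of `riemannSiegelTheta` as `∫₀ᵀ (Re ψ(1/4+iu/2)/2 − (log π)/2) du`). [folklore] -/
theorem stub_countingLaw_theta_eq {T : ℝ} (hT : 0 ≤ T) :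
    riemannSiegelTheta T / π =
      1 / (2 * π) * (∫ u, (Icc 0 T).indicator (fun _ => (1 : ℝ)) u * reDigammaQuarter u) -
        T * Real.log π / (2 * π) := by
  have hcont : Continuous reDigammaQuarter := continuous_reDigammaQuarter
  have h1 : riemannSiegelTheta T =
      (∫ u in (0 : ℝ)..T, reDigammaQuarter u) / 2 - T * (Real.log π / 2) := by
    have e : riemannSiegelTheta T =
        ∫ u in (0 : ℝ)..T, (reDigammaQuarter u / 2 - Real.log π / 2) := rfl
    rw [e, intervalIntegral.integral_sub ((hcont.div_const 2).intervalIntegrable _ _)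
      intervalIntegrable_const, intervalIntegral.integral_div, intervalIntegral.integral_const,
      smul_eq_mul, sub_zero]
  have h2 : ∫ u in (0 : ℝ)..T, reDigammaQuarter u =
      ∫ u, (Icc 0 T).indicator (fun _ => (1 : ℝ)) u * reDigammaQuarter u := by
    rw [intervalIntegral.integral_of_le hT, ← integral_Icc_eq_integral_Ioc,
      ← integral_indicator measurableSet_Icc]
    congr 1 with u
    by_cases hu : u ∈ Icc 0 T
    · rw [indicator_of_mem hu, indicator_of_mem hu, one_mul]
    · rw [indicator_of_notMem hu, indicator_of_notMem hu, zero_mul]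
  rw [h1, h2]
  field_simp

/-- For a continuous `g` supported in the window with `ĝ(1/2 + iu) = Φ(u)` real on the real line and
`g(0) = T/(2π) + e`:
`Re W(g) = Re ĝ(0) + Re ĝ(1) + (1/2π) ∫ Φ(u) Re ψ(1/4 + iu/2) du − (T/(2π) + e) log π`
(no prime term on the window). [folklore] -/
theorem stub_countingLaw_weil_re {T e : ℝ} {g : ℝ → ℂ} (hg : Continuous g)
    (hgs : tsupport g ⊆ Icc (-Real.log 2) (Real.log 2)) {Φr : ℝ → ℝ}
    (hΦ : ∀ u : ℝ, weilMellin g (1 / 2 + u * I) = Φr u)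
    (hg0 : g 0 = ((T / (2 * π) + e : ℝ) : ℂ)) :
    (weilFunctional g).re = (weilMellin g 0).re + (weilMellin g 1).re +
      1 / (2 * π) * (∫ u, Φr u * reDigammaQuarter u) - (T / (2 * π) + e) * Real.log π := by
  have hprime : weilPrimeTerm g = 0 := weilPrimeTerm_eq_zero_of_tsupport_subset hg hgs
  have harch : weilArchIntegral g = ((∫ u, Φr u * reDigammaQuarter u : ℝ) : ℂ) := by
    unfold weilArchIntegral
    rw [← integral_complex_ofReal]
    congr 1 with t
    rw [hΦ t, Complex.ofReal_mul]; rfl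
  have e1 : (1 / (2 * π) : ℂ) = ((1 / (2 * π) : ℝ) : ℂ) := by push_cast; ring
  unfold weilFunctional weilPolarTerm weilArchTerm
  rw [hprime, harch, hg0, sub_zero, e1, ← Complex.ofReal_mul, ← Complex.ofReal_mul]
  simp only [Complex.add_re, Complex.sub_re, Complex.ofReal_re]
  ring

/-! ## The core estimate -/

/-- **Core estimate.** Let `0 < Δ ≤ 1`, `T ≥ 0`, `g` continuous supported in the window with
`ĝ(1/2 + iu) = Φ(u)` (`Φ` real, continuous) on the real line, `|Φ − 𝟙_{[0,T]}| ≤ 2w + 2w(· − T)`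
off `{0, T}`, `‖ĝ(0)‖, ‖ĝ(1)‖ ≤ P` and `g(0) = T/(2π) + e`. Then
`|Re W(g) − θ(T)/π| ≤ 2P + |e| log π + (1/2π)(4 ∫ w L + 2 (∫ w) log(1+T))`. [folklore] -/
theorem stub_countingLaw_core {Δ : ℝ} (hΔ0 : 0 < Δ) (hΔ1 : Δ ≤ 1) {T : ℝ} (hT : 0 ≤ T)
    (w L : ℝ → ℝ) (hw : ∀ v, w v = (1 + (Δ * v) ^ 2)⁻¹) (hL : ∀ v, L v = 5 + Real.log (1 + |v|))
    {g : ℝ → ℂ} (hg : Continuous g) (hgs : tsupport g ⊆ Icc (-Real.log 2) (Real.log 2))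
    {Φr : ℝ → ℝ} (hΦc : Continuous Φr) (hΦ : ∀ u : ℝ, weilMellin g (1 / 2 + u * I) = Φr u)
    (hdev : ∀ u : ℝ, u ≠ 0 → u ≠ T →
      |Φr u - (Icc 0 T).indicator (fun _ => (1 : ℝ)) u| ≤ 2 * w u + 2 * w (u - T))
    {P e : ℝ} (hP0 : ‖weilMellin g 0‖ ≤ P) (hP1 : ‖weilMellin g 1‖ ≤ P)
    (hg0 : g 0 = ((T / (2 * π) + e : ℝ) : ℂ)) :
    |(weilFunctional g).re - riemannSiegelTheta T / π| ≤
      2 * P + |e| * Real.log π +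
        1 / (2 * π) * (4 * (∫ v, w v * L v) + 2 * (∫ v, w v) * Real.log (1 + T)) := by
  set χ : ℝ → ℝ := (Icc 0 T).indicator (fun _ => (1 : ℝ)) with hχ
  -- the deviation and its weighted integral
  have hDm : AEStronglyMeasurable (fun u => Φr u - χ u) :=
    (hΦc.measurable.sub (measurable_const.indicator measurableSet_Icc)).aestronglyMeasurable
  obtain ⟨hDi, hDle⟩ := stub_countingLaw_dev_integral hΔ0 hΔ1 hT w L hw hL hDm hdev
  -- the indicator part is integrable
  have hχi : Integrable (fun u => χ u * reDigammaQuarter u) := by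
    have h := (continuous_reDigammaQuarter.integrableOn_Icc (μ := volume) (a := (0 : ℝ))
      (b := T)).integrable_indicator measurableSet_Icc
    refine h.congr (ae_of_all _ fun u => ?_)
    show (Icc 0 T).indicator reDigammaQuarter u = χ u * reDigammaQuarter u
    by_cases hu : u ∈ Icc 0 T
    · rw [indicator_of_mem hu, hχ, indicator_of_mem hu, one_mul]
    · rw [indicator_of_notMem hu, hχ, indicator_of_notMem hu, zero_mul]
  -- splitting `∫ Φ ψ`
  have hsplit : ∫ u, Φr u * reDigammaQuarter u =
      (∫ u, (Φr u - χ u) * reDigammaQuarter u) + ∫ u, χ u * reDigammaQuarter u := by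
    rw [← integral_add hDi hχi]
    exact integral_congr_ae (ae_of_all _ fun u => by ring)
  have hW := stub_countingLaw_weil_re hg hgs hΦ hg0
  have hθ := stub_countingLaw_theta_eq hT
  have key : (weilFunctional g).re - riemannSiegelTheta T / π =
      (weilMellin g 0).re + (weilMellin g 1).re +
        1 / (2 * π) * (∫ u, (Φr u - χ u) * reDigammaQuarter u) - e * Real.log π := by
    rw [hW, hθ, hsplit]; ring
  rw [key]
  have h1 : |(weilMellin g 0).re| ≤ P := (Complex.abs_re_le_norm _).trans hP0
  have h2 : |(weilMellin g 1).re| ≤ P := (Complex.abs_re_le_norm _).trans hP1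
  have hπ : 0 < 1 / (2 * π) := by positivity
  have h3 : |1 / (2 * π) * (∫ u, (Φr u - χ u) * reDigammaQuarter u)| ≤
      1 / (2 * π) * (4 * (∫ v, w v * L v) + 2 * (∫ v, w v) * Real.log (1 + T)) := by
    rw [abs_mul, abs_of_pos hπ]
    exact mul_le_mul_of_nonneg_left hDle hπ.le
  have hlogπ : 0 < Real.log π := Real.log_pos (by linarith [Real.pi_gt_three])
  have h4 : |e * Real.log π| = |e| * Real.log π := by rw [abs_mul, abs_of_pos hlogπ]
  set a := (weilMellin g 0).re
  set b := (weilMellin g 1).re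
  set c := 1 / (2 * π) * (∫ u, (Φr u - χ u) * reDigammaQuarter u)
  set d := e * Real.log π
  rw [abs_le]
  constructor <;> linarith [le_abs_self a, neg_abs_le a, le_abs_self b, neg_abs_le b,
    le_abs_self c, neg_abs_le c, le_abs_self d, neg_abs_le d]

/-! ## Landing anchor: the Weil side of the counting law -/

/-- **Landing anchor of this auxiliary file** (registered sub-goal `stub_countingLaw_archSide` of
item stmt-RiemannHypothesis-11195, serving the stub `stub_countingLaw`): there are `A, B` such that
for all `T ≥ 0` and every continuous `g` supported in `[-log 2, log 2]` whose transform on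
`s = 1/2 + zi` is Selberg's majorant (resp. minorant) of `𝟙_{[0,T]}` with bandwidth `(log 2)/2π`
and with `g(0) = (T ± 2π/log 2)/(2π)`, `|Re W(g) − θ(T)/π| ≤ A + B log(1 + T)`. [folklore] -/
theorem stub_countingLaw_archSide :
    ∃ A B : ℝ, ∀ T : ℝ, 0 ≤ T → ∀ g : ℝ → ℂ, Continuous g →
      tsupport g ⊆ Set.Icc (-Real.log 2) (Real.log 2) →
      ((∀ z : ℂ, Literature.NumberTheory.LFunctions.weilMellin g (1 / 2 + z * Complex.I) =
          Literature.Analysis.Fourier.selbergMajorant (Real.log 2 / (2 * Real.pi)) 0 T z) ∧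
        g 0 = (((T + 2 * Real.pi / Real.log 2) / (2 * Real.pi) : ℝ) : ℂ) ∨
       (∀ z : ℂ, Literature.NumberTheory.LFunctions.weilMellin g (1 / 2 + z * Complex.I) =
          Literature.Analysis.Fourier.selbergMinorant (Real.log 2 / (2 * Real.pi)) 0 T z) ∧
        g 0 = (((T - 2 * Real.pi / Real.log 2) / (2 * Real.pi) : ℝ) : ℂ)) →
      |(Literature.NumberTheory.LFunctions.weilFunctional g).re -
          Literature.NumberTheory.LFunctions.riemannSiegelTheta T / Real.pi| ≤
        A + B * Real.log (1 + T) := by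
  obtain ⟨Δ, hΔ⟩ : ∃ Δ : ℝ, Δ = Real.log 2 / (2 * Real.pi) := ⟨_, rfl⟩
  rw [← hΔ]
  have hlog2 : 0 < Real.log 2 := Real.log_pos one_lt_two
  have hΔ0 : 0 < Δ := by rw [hΔ]; positivity
  have hΔ1 : Δ ≤ 1 := by
    rw [hΔ, div_le_one (by positivity)]
    linarith [Real.log_two_lt_d9, Real.pi_gt_three]
  obtain ⟨w, hw⟩ : ∃ w : ℝ → ℝ, ∀ v, w v = (1 + (Δ * v) ^ 2)⁻¹ := ⟨_, fun v => rfl⟩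
  obtain ⟨L, hL⟩ : ∃ L : ℝ → ℝ, ∀ v, L v = 5 + Real.log (1 + |v|) := ⟨_, fun v => rfl⟩
  set P : ℝ := 3 * Real.exp (2 * π) * Real.exp (2 * π * Δ) with hP
  refine ⟨2 * P + |1 / Real.log 2| * Real.log π + 1 / (2 * π) * (4 * ∫ v, w v * L v),
    1 / (2 * π) * (2 * ∫ v, w v), ?_⟩
  intro T hT g hg hgs hcase
  -- the polar points `s = 0, 1` are `1/2 + zi` with `z = ± i/2`
  have e0 : (1 : ℂ) / 2 + I / 2 * I = 0 := by linear_combination Complex.I_mul_I / 2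
  have e1 : (1 : ℂ) / 2 + -I / 2 * I = 1 := by linear_combination -Complex.I_mul_I / 2
  have him0 : |(I / 2 : ℂ).im| ≤ 1 := by norm_num
  have him1 : |(-I / 2 : ℂ).im| ≤ 1 := by norm_num
  have hexp : ∀ z : ℂ, |z.im| ≤ 1 →
      3 * Real.exp (2 * π) * Real.exp (2 * π * Δ * |z.im|) ≤ P := by
    intro z hz
    rw [hP]
    refine mul_le_mul_of_nonneg_left (Real.exp_le_exp.2 ?_) (by positivity)
    exact mul_le_of_le_one_right (by positivity) hz
  -- reduction of both cases to the core estimate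
  have main : ∀ (Φ : ℂ → ℂ) (Φr : ℝ → ℝ) (e : ℝ),
      (∀ z : ℂ, weilMellin g (1 / 2 + z * I) = Φ z) → (∀ x : ℝ, Φ x = (Φr x : ℂ)) →
      Continuous Φr →
      (∀ z : ℂ, ‖Φ z‖ ≤ 3 * Real.exp (2 * π) * Real.exp (2 * π * Δ * |z.im|)) →
      (∀ u : ℝ, u ≠ 0 → u ≠ T →
        |Φr u - (Icc 0 T).indicator (fun _ => (1 : ℝ)) u| ≤ 2 * w u + 2 * w (u - T)) →
      g 0 = ((T / (2 * π) + e : ℝ) : ℂ) → |e| = |1 / Real.log 2| →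
      |(weilFunctional g).re - riemannSiegelTheta T / π| ≤
        2 * P + |1 / Real.log 2| * Real.log π + 1 / (2 * π) * (4 * ∫ v, w v * L v) +
          1 / (2 * π) * (2 * ∫ v, w v) * Real.log (1 + T) := by
    intro Φ Φr e hmel hreal hΦc hnorm hdev hg0 he
    have hΦ : ∀ u : ℝ, weilMellin g (1 / 2 + u * I) = Φr u := fun u => by rw [hmel, hreal]
    have hP0 : ‖weilMellin g 0‖ ≤ P := by
      rw [← e0, hmel]; exact (hnorm _).trans (hexp _ him0)
    have hP1 : ‖weilMellin g 1‖ ≤ P := by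
      rw [← e1, hmel]; exact (hnorm _).trans (hexp _ him1)
    have h := stub_countingLaw_core hΔ0 hΔ1 hT w L hw hL hg hgs hΦc hΦ hdev hP0 hP1 hg0
    rw [he] at h
    linarith
  rcases hcase with ⟨hmel, hg0⟩ | ⟨hmel, hg0⟩
  · refine main (selbergMajorant Δ 0 T) (selbergMajorantReal Δ 0 T) (1 / Real.log 2) hmel
      (selbergMajorant_ofReal Δ 0 T) (continuous_selbergMajorantReal Δ 0 T)
      (norm_selbergMajorant_le hΔ0 0 T)
      (fun u hu0 huT => by rw [hw, hw]; exact stub_countingLaw_majorant_dev hΔ0 hT hu0 huT)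
      ?_ rfl
    rw [hg0]; congr 1; field_simp
  · refine main (selbergMinorant Δ 0 T) (selbergMinorantReal Δ 0 T) (-(1 / Real.log 2)) hmel
      (selbergMinorant_ofReal Δ 0 T) (continuous_selbergMinorantReal Δ 0 T)
      (norm_selbergMinorant_le hΔ0 0 T)
      (fun u hu0 huT => by rw [hw, hw]; exact stub_countingLaw_minorant_dev hΔ0 hT hu0 huT)
      ?_ (abs_neg _)
    rw [hg0]; congr 1; field_simp; ring

end Summit.RiemannHypothesis.RiemannHypothesis.Theorems.SpectralTraceWindowTraceArch

end
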